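import Summits.QuantumFields.QCD.Theorems.QuarksAsStableActionCriticalLineDiamagnetismCellDefs
import Summits.QuantumFields.QCD.Theorems.QuarksAsStableActionCriticalLineDiamagnetismCellInvert
import Summits.QuantumFields.QCD.Theorems.QuarksAsStableActionCriticalLineDiamagnetismCellFirstOrder
import Summits.QuantumFields.QCD.Theorems.QuarksAsStableActionCriticalLineDiamagnetismCellSecondOrderMain
import Summits.QuantumFields.QCD.Theorems.QuarksAsStableActionCriticalLineDiamagnetismCellSecondOrderAux4
import Summits.QuantumFields.QCD.Theorems.QuarksAsStableActionCriticalLineDiamagnetismLogDetSecondOrder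
import Mathlib.Analysis.CStarAlgebra.Matrix
import Mathlib.LinearAlgebra.Eigenspace.Matrix

/-!
# The B6 cell lemma `cellLemma` (crux `stmt-QuantumFields-9734`, line `Sketch`, Route B of `stub_heavyFrequencyGain`)

Sub-problem context: `Summits/QuantumFields/QCD/Statement.lean`; crux decl
`Summit.QuantumFields.QCD.Theses.QuarksAsStableAction.CriticalLineDiamagnetism`.  Pure theorem file: the registered helper stub
`cellLemma` — the checkerboard of one plaquette on the `2n × 2n` torus (`n ≥ 12`) gains `n²·def/3000` on good plaquettes
(`def < 10⁻⁸`) and costs at most `1200 n²`, relative to the free field at a heavy frequency — composed from the landed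
`cellInvert` (Neumann control), `cellFirstOrder` (exact first order + planar identification), `cellSecondOrderOfTwelve` (bubble
bound), `logDetSecondOrder`, and the certified inequality `CellKappaClaim` (hypothesis; discharged by `CellKappa.cellKappaClaim_holds`).
References: M. Salmhofer, E. Seiler, Commun. Math. Phys. 139 (1991) 395; lead's plan `work/odd/S4-PLAN.md` §B6.
-/
noncomputable section
open scoped BigOperators Matrix
open Matrix Literature.MathematicalPhysics.QuantumLattice
open Summit.QuantumFields.QCD.Cruxes.CriticalLineDiamagnetism.ChessboardCellGain.FrequencyDiamagnetism
open Summit.QuantumFields.QCD.Cruxes.CriticalLineDiamagnetism.ChessboardCellGain.CellKappa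

namespace Summit.QuantumFields.QCD.Cruxes.CriticalLineDiamagnetism.ChessboardCellGain
open Cell

/-! ## The composition `cellLemma` -/

/-- Crude bound: if every root of the characteristic polynomial has modulus `≤ 13/25` then
`log ‖det(1 + X)‖ ≤ 25 · dim`. -/
theorem log_norm_det_one_add_le_crude {k : Type} [Fintype k] [DecidableEq k] (Y : Matrix k k ℂ)
    (h : ∀ μ : ℂ, μ ∈ spectrum ℂ Y → ‖μ‖ ≤ 13 / 25) :
    Real.log ‖(1 + Y).det‖ ≤ 25 * Fintype.card k := by
  have hroots : ∀ μ ∈ Y.charpoly.roots, ‖μ‖ ≤ 13 / 25 := fun μ hμ =>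
    h μ (Matrix.mem_spectrum_of_isRoot_charpoly ((Polynomial.mem_roots Y.charpoly_monic.ne_zero).mp hμ))
  have hdet : (1 + Y).det = (Y.charpoly.roots.map fun μ => 1 + μ).prod :=
    Literature.Analysis.InnerProduct.matrix_det_one_add_eq_prod_roots_charpoly Y
  have hcard : Multiset.card Y.charpoly.roots = Fintype.card k := by
    rw [← (IsAlgClosed.splits Y.charpoly).natDegree_eq_card_roots, Matrix.charpoly_natDegree_eq_dim]
  -- ‖∏ (1 + μ)‖ ≤ (38/25)^card
  have hprod : ∀ s : Multiset ℂ, (∀ μ ∈ s, ‖μ‖ ≤ 13 / 25) →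
      ‖(s.map fun μ => 1 + μ).prod‖ ≤ (38 / 25 : ℝ) ^ Multiset.card s := by
    intro s
    induction s using Multiset.induction_on with
    | empty => intro; simp
    | cons a s ih =>
      intro hs
      rw [Multiset.map_cons, Multiset.prod_cons, Multiset.card_cons, pow_succ']
      have ha : ‖1 + a‖ ≤ 38 / 25 := by
        calc ‖1 + a‖ ≤ ‖(1 : ℂ)‖ + ‖a‖ := norm_add_le _ _
          _ ≤ 1 + 13 / 25 := by rw [norm_one]; linarith [hs a (Multiset.mem_cons_self a s)]
          _ = 38 / 25 := by norm_num
      calc ‖(1 + a) * (s.map fun μ => 1 + μ).prod‖ ≤ ‖1 + a‖ * ‖(s.map fun μ => 1 + μ).prod‖ := norm_mul_le _ _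
        _ ≤ 38 / 25 * (38 / 25 : ℝ) ^ Multiset.card s :=
          mul_le_mul ha (ih fun μ hμ => hs μ (Multiset.mem_cons_of_mem hμ)) (norm_nonneg _) (by norm_num)
  have hb := hprod _ hroots
  rw [← hdet, hcard] at hb
  by_cases h0 : ‖(1 + Y).det‖ = 0
  · rw [h0, Real.log_zero]; positivity
  calc Real.log ‖(1 + Y).det‖ ≤ Real.log ((38 / 25 : ℝ) ^ Fintype.card k) :=
        Real.log_le_log (lt_of_le_of_ne (norm_nonneg _) (Ne.symm h0)) hb
    _ = Fintype.card k * Real.log (38 / 25) := by rw [Real.log_pow]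
    _ ≤ Fintype.card k * 25 := by
        refine mul_le_mul_of_nonneg_left ?_ (Nat.cast_nonneg _)
        have := Real.log_le_sub_one_of_pos (show (0 : ℝ) < 38 / 25 by norm_num)
        linarith
    _ = 25 * Fintype.card k := by ring

/-- The real arithmetic of the good-plaquette case of `cellLemma`. -/
theorem cellLemma_good_arith (ρ d n2 T1 T2 LG α κ b : ℝ) (hρ0 : 0 ≤ ρ) (hρ1 : ρ ≤ 13 / 25)
    (hρ2 : ρ ≤ 13 / 50 * Real.sqrt (2 * d)) (hd0 : 0 ≤ d) (hgood : d < 1 / 10 ^ 8) (hn2 : 0 ≤ n2)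
    (hlog : LG ≤ T1 - T2 / 2 + 48 * n2 * ρ ^ 3 / (3 * (1 - ρ))) (htr : T1 = -4 * n2 * α * d)
    (hsec : |T2| ≤ 8 * n2 * d * (b + 1 / 10 ^ 4)) (hα : |α - κ| ≤ 1 / 10 ^ 6) (hclaim : 1 / 4000 ≤ κ - b) :
    LG ≤ n2 * (-(1 / 3000) * d) := by
  have hsq : Real.sqrt (2 * d) ≤ 3 / 20000 := by
    rw [Real.sqrt_le_left (by norm_num)]; nlinarith
  have hρsmall : ρ ≤ 1 / 25000 := by nlinarith [Real.sqrt_nonneg (2 * d)]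
  have hρsq : ρ ^ 2 ≤ (13 / 50) ^ 2 * (2 * d) := by
    have h2 : (13 / 50 * Real.sqrt (2 * d)) ^ 2 = (13 / 50) ^ 2 * (2 * d) := by
      rw [mul_pow, Real.sq_sqrt (by positivity)]
    nlinarith [Real.sqrt_nonneg (2 * d)]
  have hρ3 : ρ ^ 3 ≤ (13 / 50) ^ 2 * (2 * d) * (1 / 25000) := by
    calc ρ ^ 3 = ρ ^ 2 * ρ := by ring
      _ ≤ (13 / 50) ^ 2 * (2 * d) * (1 / 25000) := mul_le_mul hρsq hρsmall hρ0 (by positivity)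
  have hscal : 48 * ρ ^ 3 / (3 * (1 - ρ)) ≤ d / 4000 := by
    rw [div_le_iff₀ (by linarith)]
    nlinarith
  have hrem : 48 * n2 * ρ ^ 3 / (3 * (1 - ρ)) ≤ n2 * (d / 4000) := by
    calc 48 * n2 * ρ ^ 3 / (3 * (1 - ρ)) = n2 * (48 * ρ ^ 3 / (3 * (1 - ρ))) := by ring
      _ ≤ n2 * (d / 4000) := mul_le_mul_of_nonneg_left hscal hn2
  have hsec' : -T2 / 2 ≤ 4 * n2 * d * (b + 1 / 10 ^ 4) := by
    have : -T2 ≤ |T2| := neg_le_abs _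
    linarith
  have hα' : κ - 1 / 10 ^ 6 ≤ α := by have := (abs_le.mp hα).1; linarith
  have hn2d : (0 : ℝ) ≤ n2 * d := by positivity
  have hcoef : -4 * α + 4 * (b + 1 / 10 ^ 4) + 1 / 4000 ≤ -(1 / 3000) := by linarith
  have hmul := mul_le_mul_of_nonneg_left hcoef hn2d
  calc LG ≤ T1 - T2 / 2 + 48 * n2 * ρ ^ 3 / (3 * (1 - ρ)) := hlog
    _ ≤ -4 * n2 * α * d + 4 * n2 * d * (b + 1 / 10 ^ 4) + n2 * (d / 4000) := by rw [htr]; linarith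
    _ = n2 * d * (-4 * α + 4 * (b + 1 / 10 ^ 4) + 1 / 4000) := by ring
    _ ≤ n2 * d * (-(1 / 3000)) := hmul
    _ = n2 * (-(1 / 3000) * d) := by ring

/-- `cellLemma` in terms of the cell objects `DP`, `D1`, `defi` (constants `δ₀ = 10⁻⁸`, `c₀ = 1/3000`, `C₀ = 1200`). -/
theorem cellLemma_cell (hK : CellKappaClaim) : ∀ (n : ℕ) [NeZero n], 12 ≤ n →
    ∀ (m : ℝ), |m| ≤ 1 / 10 → ∀ ω₀ ω₁ : ℝ, Real.cos ω₀ ≤ -(199 / 200) → Real.cos ω₁ ≤ -(199 / 200) →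
    ∀ (P : Matrix.unitaryGroup (Fin 3) ℂ),
    Real.log ‖(DP n P m ω₀ ω₁).det‖ ≤ Real.log ‖(D1 n m ω₀ ω₁).det‖ +
      (n : ℝ) ^ 2 * (if defi P < 1 / 10 ^ 8 then -(1 / 3000) * defi P else 1200) := by
  intro n _ hn m hm ω₀ ω₁ h0 h1 P
  obtain ⟨hU, hfac, hev⟩ := cellInvert n m hm ω₀ ω₁ h0 h1 P
  have hd0 : 0 ≤ defi P := CellWalk.defi_nonneg P
  -- the spectral radius bound `ρ`
  obtain ⟨ρ, hρ⟩ : ∃ ρ : ℝ, ρ = min (13 / 25) (13 / 50 * Real.sqrt (2 * defi P)) := ⟨_, rfl⟩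
  have hρ0 : 0 ≤ ρ := by rw [hρ]; exact le_min (by norm_num) (by positivity)
  have hρ1 : ρ ≤ 13 / 25 := by rw [hρ]; exact min_le_left _ _
  have hρ2 : ρ ≤ 13 / 50 * Real.sqrt (2 * defi P) := by rw [hρ]; exact min_le_right _ _
  -- spectrum bridge
  have hspec : ∀ μ : ℂ, μ ∈ spectrum ℂ (X n P m ω₀ ω₁) → ‖μ‖ ≤ ρ := by
    intro μ hμ
    rw [← Matrix.spectrum_toLin'] at hμ
    rw [hρ]; exact hev μ (Module.End.hasEigenvalue_iff_mem_spectrum.mpr hμ)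
  -- determinant factorisation and the log split
  obtain ⟨hne, hlog⟩ := logDetSecondOrder (X n P m ω₀ ω₁) ρ hρ0 (by linarith) hspec
  have hD1 : ‖(D1 n m ω₀ ω₁).det‖ ≠ 0 := norm_ne_zero_iff.mpr hU.ne_zero
  have hsplit : Real.log ‖(DP n P m ω₀ ω₁).det‖ =
      Real.log ‖(D1 n m ω₀ ω₁).det‖ + Real.log ‖(1 + X n P m ω₀ ω₁).det‖ := by
    rw [hfac, Matrix.det_mul, norm_mul, Real.log_mul hD1 (norm_ne_zero_iff.mpr hne)]
  rw [hsplit, add_le_add_iff_left]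
  -- dimension
  have hcard : (Fintype.card ((ZMod (2 * n) × ZMod (2 * n)) × Fin 3 × Fin 4) : ℝ) = 48 * (n : ℝ) ^ 2 := by
    simp only [Fintype.card_prod, ZMod.card, Fintype.card_fin]; push_cast; ring
  rw [hcard] at hlog
  -- name the scalar quantities
  obtain ⟨T1, hT1⟩ : ∃ t : ℝ, t = (X n P m ω₀ ω₁).trace.re := ⟨_, rfl⟩
  obtain ⟨T2, hT2⟩ : ∃ t : ℝ, t = ((X n P m ω₀ ω₁) * (X n P m ω₀ ω₁)).trace.re := ⟨_, rfl⟩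
  obtain ⟨LG, hLG⟩ : ∃ t : ℝ, t = Real.log ‖(1 + X n P m ω₀ ω₁).det‖ := ⟨_, rfl⟩
  obtain ⟨d, hd⟩ : ∃ t : ℝ, t = defi P := ⟨_, rfl⟩
  rw [← hT1, ← hT2, ← hLG] at hlog
  rw [← hLG, ← hd]
  rw [← hd] at hd0 hρ2
  have hn2 : (0 : ℝ) ≤ (n : ℝ) ^ 2 := by positivity
  split_ifs with hgood
  · -- GOOD plaquette: second-order expansion + certificate
    obtain ⟨htr, hα⟩ := cellFirstOrder n (le_trans (by norm_num) hn) m hm ω₀ ω₁ h0 h1 P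
    have hsec := cellSecondOrderOfTwelve n hn m hm ω₀ ω₁ h0 h1 P
    rw [sq] at hsec
    rw [← hT1, ← hd] at htr
    rw [← hT2, ← hd] at hsec
    -- parameter ranges for the certificate
    have hM1 : (589 : ℝ) / 100 ≤ bigM m ω₀ ω₁ := by unfold bigM; have := (abs_le.mp hm).1; linarith
    have hM2 : bigM m ω₀ ω₁ ≤ 61 / 10 := by
      unfold bigM; have := (abs_le.mp hm).2; have := Real.neg_one_le_cos ω₀; have := Real.neg_one_le_cos ω₁; linarith
    have hsin : ∀ ω : ℝ, Real.cos ω ≤ -(199 / 200) → |Real.sin ω| ≤ 1 / 10 := by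
      intro ω hω
      have hc : (199 / 200 : ℝ) ^ 2 ≤ Real.cos ω ^ 2 := by nlinarith [Real.neg_one_le_cos ω]
      have hs : Real.sin ω ^ 2 ≤ (1 / 10) ^ 2 := by nlinarith [Real.sin_sq_add_cos_sq ω]
      exact abs_le_of_sq_le_sq' hs (by norm_num) |>.elim (fun h1 h2 => abs_le.mpr ⟨h1, h2⟩)
    have hclaim := hK (bigM m ω₀ ω₁) (Real.sin ω₀) (Real.sin ω₁) hM1 hM2 (hsin ω₀ h0) (hsin ω₁ h1)
    -- name the certificate quantities
    obtain ⟨κ, hκ⟩ : ∃ t : ℝ, t = kappaOne (bigM m ω₀ ω₁) (Real.sin ω₀) (Real.sin ω₁) 14 := ⟨_, rfl⟩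
    obtain ⟨b, hb⟩ : ∃ t : ℝ, t = bubbleAbs (bigM m ω₀ ω₁) (Real.sin ω₀) (Real.sin ω₁) 14 7 := ⟨_, rfl⟩
    obtain ⟨α, hαd⟩ : ∃ t : ℝ, t = (alphaTor n m ω₀ ω₁).re := ⟨_, rfl⟩
    rw [← hκ, ← hb] at hclaim
    rw [← hαd, ← hκ] at hα
    rw [← hαd] at htr
    rw [← hb] at hsec
    exact cellLemma_good_arith ρ d _ T1 T2 LG α κ b hρ0 hρ1 hρ2 hd0 hgood hn2 hlog htr hsec hα hclaim
  · -- BAD plaquette: crude bound from the spectral radius ≤ 13/25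
    have hcr := log_norm_det_one_add_le_crude (X n P m ω₀ ω₁) (fun μ hμ => (hspec μ hμ).trans hρ1)
    rw [hcard, ← hLG] at hcr
    nlinarith

/-- **`cellLemma`** (B6, composition): modulo the certified inequality `CellKappaClaim`, the checkerboard of one plaquette
gains `n² · def(P) / 3000` on good plaquettes (`def < 10⁻⁸`) and costs at most `1200 · n²` always, relative to the free field (`n ≥ 12`).
Composition of `cellInvert` (Neumann control), `cellFirstOrder` (exact first order + planar identification), `cellSecondOrder`
(bubble bound), `logDetSecondOrder` (…CriticalLineDiamagnetismLogDetSecondOrder) and `CellKappaClaim` at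
`(M_ω, sin ω₀, sin ω₁)`. -/
theorem cellLemma : CellKappaClaim → ∃ δ₀ c₀ C₀ : ℝ, 0 < δ₀ ∧ 0 < c₀ ∧ ∀ (n : ℕ) [NeZero n], 12 ≤ n →
    ∀ (m : ℝ), |m| ≤ 1 / 10 → ∀ ω₀ ω₁ : ℝ, Real.cos ω₀ ≤ -(199 / 200) → Real.cos ω₁ ≤ -(199 / 200) →
    ∀ (P : Matrix.unitaryGroup (Fin 3) ℂ),
    Real.log ‖(freqOpR euclideanGamma (fun (a b : ZMod (2 * n)) (μ : Fin 4) =>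
          if μ = 2 ∧ b.val % 2 = 1 then (if a.val % 2 = 0 then P else P⁻¹) else 1) m ω₀ ω₁).det‖ ≤
      Real.log ‖(freqOpR euclideanGamma (fun (_ _ : ZMod (2 * n)) (_ : Fin 4) => (1 : Matrix.unitaryGroup (Fin 3) ℂ)) m ω₀ ω₁).det‖ +
        (n : ℝ) ^ 2 * (if 3 - ((P : Matrix (Fin 3) (Fin 3) ℂ).trace).re < δ₀ then -c₀ * (3 - ((P : Matrix (Fin 3) (Fin 3) ℂ).trace).re) else C₀) := by
  intro hK
  refine ⟨1 / 10 ^ 8, 1 / 3000, 1200, by norm_num, by norm_num, ?_⟩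
  intro n _ hn m hm ω₀ ω₁ h0 h1 P
  exact cellLemma_cell hK n hn m hm ω₀ ω₁ h0 h1 P

end Summit.QuantumFields.QCD.Cruxes.CriticalLineDiamagnetism.ChessboardCellGain
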